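import Literature.AlgebraicGeometry.Hu2025.Proofs.S03Pluecker.Prop36
import Literature.AlgebraicGeometry.Hu2025.Proofs.S03Pluecker.KeyTrick
import Mathlib.Data.Finsupp.Weight
import HarnessLib

/-!
# Hu 2025 §3.3 — the LITERAL reading `C18L166_R2` («every F̄_{h,k} … can be expressed as a polynomial in the … F̄_{m,u}» read as membership in the
# SUBALGEBRA `k[𝓕_m]`) is FALSE AS TYPED at `n = 5` over every nontrivial base ring: `not_C18L166_R2_five` (row 101b, typer res-type-009).
# Together with `C18L166_holds` (the IDEAL reading the paper's own Ex 3.9 illustrates) this records why row 101b carries two readings.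

**HONEST FRAMING (D-0012/D-0089).** A theorem about OUR typed transcription; the sibling `C18L166` (ideal reading) is kernel-true (`PlueckerIdeal.lean`);
the preprint [Hu2025] stays «under review» and no view is taken on which reading the author intends beyond recording that Ex 3.9's expansion
«p₄₅F₁ = p₃₄F₃ − p₂₄F₄ + p₁₄F₅» has polynomial COEFFICIENTS. Proof: weight the chart variables by `w(x_u) = 2` for `u ∈ 𝕀^lt` and `w = 1` for basic
variables; for `n = 5` every m-primary relation `F̄_{m,u} = x_u − (basic)(basic) + (basic)(basic)` has only monomials of EVEN weight, hence so does
every element of the subalgebra `k[𝓕_m]`; but the de-homogenised Plücker relation `F̄_{(14),(2345)} = −x₁₂₄x₃₄₅ + x₁₃₄x₂₄₅ − x₁₄₅x₂₃₄` has the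
monomial `x₁₂₄x₃₄₅` of weight `3` with coefficient `−1 ≠ 0`. AI proof, weaker than expert review; nothing here is progress on resolution of singularities.
-/

noncomputable section

namespace Literature.AlgebraicGeometry.Hu2025.Statements.S03Pluecker

open MvPolynomial
open scoped Pointwise

universe u

variable (k : Type u) [CommRing k]

/-! ## §1 The even-weight subalgebra -/

/-- The weight: `2` on leading (`𝕀^lt`) variables, `1` on basic variables. MODEL DATA.
[cite: Hu2025, §3c closing question (C18L166), p.39 l.30–34 (unrefereed preprint arXiv:2507.21400v1 under adjudication, D-0012/D-0089
— kernel support on OUR typed carriers of row 101; nothing of the source asserted)] -/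
def pweight {n : ℕ} (x : plVar n) : ℕ := if IsLt x.1 then 2 else 1

/-- The subalgebra of `k[x_u]` of polynomials all of whose monomials have EVEN weighted degree.
[cite: Hu2025, §3c closing question (C18L166), p.39 l.30–34 (unrefereed preprint arXiv:2507.21400v1 under adjudication, D-0012/D-0089
— kernel support on OUR typed carriers of row 101; nothing of the source asserted)] -/
def evenSub (n : ℕ) : Subalgebra k (ChartRing n k) where
  carrier := {f | ∀ d ∈ f.support, Even (Finsupp.weight (pweight (n := n)) d)}
  mul_mem' := by
    classical
    intro f g hf hg d hd
    obtain ⟨a, ha, b, hb, rfl⟩ := Finset.mem_add.mp (support_mul f g hd)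
    rw [map_add]
    exact (hf a ha).add (hg b hb)
  add_mem' := by
    classical
    intro f g hf hg d hd
    rcases Finset.mem_union.mp (support_add hd) with h | h
    · exact hf d h
    · exact hg d h
  algebraMap_mem' := by
    intro c d hd
    rw [algebraMap_eq] at hd
    have : d = 0 := by
      have h := support_monomial_subset hd
      rwa [Finset.mem_singleton] at h
    rw [this, map_zero]
    exact ⟨0, rfl⟩

variable {k}

/-- A leading variable lies in the even subalgebra (weight `2`).
[cite: Hu2025, §3c closing question (C18L166), p.39 l.30–34 (unrefereed preprint arXiv:2507.21400v1 under adjudication, D-0012/D-0089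
— kernel support on OUR typed carriers of row 101; nothing of the source asserted)] -/
theorem X_mem_evenSub {n : ℕ} (x : plVar n) (hx : IsLt x.1) : (X x : ChartRing n k) ∈ evenSub k n := by
  intro d hd
  have h := support_monomial_subset hd
  rw [Finset.mem_singleton] at h
  rw [h, Finsupp.weight_single, pweight, if_pos hx]
  exact ⟨1, rfl⟩

/-- A product of two basic variables lies in the even subalgebra (weight `1 + 1`).
[cite: Hu2025, §3c closing question (C18L166), p.39 l.30–34 (unrefereed preprint arXiv:2507.21400v1 under adjudication, D-0012/D-0089
— kernel support on OUR typed carriers of row 101; nothing of the source asserted)] -/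
theorem X_mul_X_mem_evenSub {n : ℕ} (x y : plVar n) (hx : ¬ IsLt x.1) (hy : ¬ IsLt y.1) :
    (X x * X y : ChartRing n k) ∈ evenSub k n := by
  intro d hd
  rw [X, X, monomial_mul] at hd
  have h := support_monomial_subset hd
  rw [Finset.mem_singleton] at h
  rw [h, map_add, Finsupp.weight_single, Finsupp.weight_single, pweight, pweight, if_neg hx, if_neg hy]
  exact ⟨1, rfl⟩

/-! ## §2 `n = 5`: the three primary relations lie in the even subalgebra -/

/-- The leading indices for `n = 5` are `(1,4,5), (2,4,5), (3,4,5)`.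
[cite: Hu2025, §3c closing question (C18L166), p.39 l.30–34 (unrefereed preprint arXiv:2507.21400v1 under adjudication, D-0012/D-0089
— kernel support on OUR typed carriers of row 101; nothing of the source asserted)] -/
theorem isLt_five_cases {u : ℕ × ℕ × ℕ} (hu : u ∈ plIndexSet 5) (hlt : IsLt u) :
    u = (1, 4, 5) ∨ u = (2, 4, 5) ∨ u = (3, 4, 5) := by
  have h3 := three_lt_of_isLt (n := 5) hu hlt
  obtain ⟨u₁, u₂, u₃⟩ := u
  rw [mem_plIndexSet_iff] at hu
  simp only at hu h3
  simp only [Prod.mk.injEq]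
  omega

/-- `F̄_{m,(i45)} ∈` the even subalgebra, `i = 1, 2, 3` (`n = 5`).
[cite: Hu2025, §3c closing question (C18L166), p.39 l.30–34 (unrefereed preprint arXiv:2507.21400v1 under adjudication, D-0012/D-0089
— kernel support on OUR typed carriers of row 101; nothing of the source asserted)] -/
theorem primaryRelBar_mem_evenSub_five {u : ℕ × ℕ × ℕ} (hu : u ∈ plIndexSet 5) (hlt : IsLt u) :
    primaryRelBar 5 k u ∈ evenSub k 5 := by
  have B : ∀ a b c : ℕ, 1 ≤ a → a < b → b ≤ 3 → b < c → c ≤ 5 → 3 < c →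
      ∃ h : (a, b, c) ∈ plVarSet 5, (xbar k (a, b, c) : ChartRing 5 k) = X ⟨(a, b, c), h⟩ ∧ ¬ IsLt (a, b, c) :=
    fun a b c ha hab hb3 hbc hc h3c => ⟨mem_plVarSet ha hab hbc hc h3c, xbar_of_mem k _, not_isLt_of_le ha hab hb3⟩
  rw [primaryRelBar_eq k _ hlt, xbar_mTri, mul_one]
  rcases isLt_five_cases hu hlt with rfl | rfl | rfl <;> simp only
  · obtain ⟨hu', e0, -⟩ : ∃ h : ((1:ℕ),(4:ℕ),(5:ℕ)) ∈ plVarSet 5, (xbar k (1,4,5) : ChartRing 5 k) = X ⟨_, h⟩ ∧ True :=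
      ⟨mem_plVarSet (by norm_num) (by norm_num) (by norm_num) le_rfl (by norm_num), xbar_of_mem k _, trivial⟩
    obtain ⟨h1, e1, n1⟩ := B 1 2 4 (by norm_num) (by norm_num) (by norm_num) (by norm_num) (by norm_num) (by norm_num)
    obtain ⟨h2, e2, n2⟩ := B 1 3 5 (by norm_num) (by norm_num) le_rfl (by norm_num) le_rfl (by norm_num)
    obtain ⟨h3, e3, n3⟩ := B 1 3 4 (by norm_num) (by norm_num) le_rfl (by norm_num) (by norm_num) (by norm_num)
    obtain ⟨h4, e4, n4⟩ := B 1 2 5 (by norm_num) (by norm_num) (by norm_num) (by norm_num) le_rfl (by norm_num)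
    rw [if_pos trivial, e0, e1, e2, e3, e4]
    exact Subalgebra.add_mem _ (Subalgebra.sub_mem _ (X_mem_evenSub _ hlt) (X_mul_X_mem_evenSub _ _ n1 n2))
      (X_mul_X_mem_evenSub _ _ n3 n4)
  · obtain ⟨hu', e0, -⟩ : ∃ h : ((2:ℕ),(4:ℕ),(5:ℕ)) ∈ plVarSet 5, (xbar k (2,4,5) : ChartRing 5 k) = X ⟨_, h⟩ ∧ True :=
      ⟨mem_plVarSet (by norm_num) (by norm_num) (by norm_num) le_rfl (by norm_num), xbar_of_mem k _, trivial⟩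
    obtain ⟨h1, e1, n1⟩ := B 1 2 4 (by norm_num) (by norm_num) (by norm_num) (by norm_num) (by norm_num) (by norm_num)
    obtain ⟨h2, e2, n2⟩ := B 2 3 5 (by norm_num) (by norm_num) le_rfl (by norm_num) le_rfl (by norm_num)
    obtain ⟨h3, e3, n3⟩ := B 2 3 4 (by norm_num) (by norm_num) le_rfl (by norm_num) (by norm_num) (by norm_num)
    obtain ⟨h4, e4, n4⟩ := B 1 2 5 (by norm_num) (by norm_num) (by norm_num) (by norm_num) le_rfl (by norm_num)
    rw [if_pos trivial, e0, e1, e2, e3, e4]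
    exact Subalgebra.add_mem _ (Subalgebra.sub_mem _ (X_mem_evenSub _ hlt) (X_mul_X_mem_evenSub _ _ n1 n2))
      (X_mul_X_mem_evenSub _ _ n3 n4)
  · obtain ⟨hu', e0, -⟩ : ∃ h : ((3:ℕ),(4:ℕ),(5:ℕ)) ∈ plVarSet 5, (xbar k (3,4,5) : ChartRing 5 k) = X ⟨_, h⟩ ∧ True :=
      ⟨mem_plVarSet (by norm_num) (by norm_num) (by norm_num) le_rfl (by norm_num), xbar_of_mem k _, trivial⟩
    obtain ⟨h1, e1, n1⟩ := B 1 3 4 (by norm_num) (by norm_num) le_rfl (by norm_num) (by norm_num) (by norm_num)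
    obtain ⟨h2, e2, n2⟩ := B 2 3 5 (by norm_num) (by norm_num) le_rfl (by norm_num) le_rfl (by norm_num)
    obtain ⟨h3, e3, n3⟩ := B 2 3 4 (by norm_num) (by norm_num) le_rfl (by norm_num) (by norm_num) (by norm_num)
    obtain ⟨h4, e4, n4⟩ := B 1 3 5 (by norm_num) (by norm_num) le_rfl (by norm_num) le_rfl (by norm_num)
    rw [if_pos trivial, e0, e1, e2, e3, e4]
    exact Subalgebra.add_mem _ (Subalgebra.sub_mem _ (X_mem_evenSub _ hlt) (X_mul_X_mem_evenSub _ _ n1 n2))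
      (X_mul_X_mem_evenSub _ _ n3 n4)

/-- `k[𝓕_m] ⊆` the even subalgebra (`n = 5`).
[cite: Hu2025, §3c closing question (C18L166), p.39 l.30–34 (unrefereed preprint arXiv:2507.21400v1 under adjudication, D-0012/D-0089
— kernel support on OUR typed carriers of row 101; nothing of the source asserted)] -/
theorem adjoin_primaryFamily_le_evenSub_five : Algebra.adjoin k (primaryFamily 5 k) ≤ evenSub k 5 := by
  rw [Algebra.adjoin_le_iff]
  rintro F ⟨u, hlt, rfl⟩
  exact primaryRelBar_mem_evenSub_five u.2 hlt

/-! ## §3 The Plücker relation `F̄_{(14),(2345)}` has an odd-weight monomial -/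

/-- `F̄_{(14),(2345)} = −x₁₂₄x₃₄₅ + x₁₃₄x₂₄₅ − x₁₄₅x₂₃₄` on the chart.
[cite: Hu2025, §3c closing question (C18L166), p.39 l.30–34 (unrefereed preprint arXiv:2507.21400v1 under adjudication, D-0012/D-0089
— kernel support on OUR typed carriers of row 101; nothing of the source asserted)] -/
theorem dehomog_plRel_14_2345 (h124 : ((1:ℕ),(2:ℕ),(4:ℕ)) ∈ plVarSet 5) (h345 : ((3:ℕ),(4:ℕ),(5:ℕ)) ∈ plVarSet 5)
    (h134 : ((1:ℕ),(3:ℕ),(4:ℕ)) ∈ plVarSet 5) (h245 : ((2:ℕ),(4:ℕ),(5:ℕ)) ∈ plVarSet 5) (h145 : ((1:ℕ),(4:ℕ),(5:ℕ)) ∈ plVarSet 5)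
    (h234 : ((2:ℕ),(3:ℕ),(4:ℕ)) ∈ plVarSet 5) :
    dehomog 5 k (plRel k 1 4 2 3 4 5) =
      -(X ⟨_, h124⟩ * X ⟨_, h345⟩) + X ⟨_, h134⟩ * X ⟨_, h245⟩ - X ⟨_, h145⟩ * X ⟨_, h234⟩ := by
  have D : ∀ (t : ℕ × ℕ × ℕ) (ht : t ∈ plIndexSet 5) (hv : t ∈ plVarSet 5),
      dehomog 5 k (pTri k t) = X ⟨t, hv⟩ := by
    intro t ht hv
    unfold pTri; rw [dif_pos ht]; unfold dehomog; rw [aeval_X]; exact xbar_of_mem k hv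
  unfold plRel
  rw [pCoord_acb k (a := 1) (b := 2) (c := 4) (by norm_num) (by norm_num), pCoord_abc k (a := 3) (b := 4) (c := 5) (by norm_num) (by norm_num),
    pCoord_acb k (a := 1) (b := 3) (c := 4) (by norm_num) (by norm_num), pCoord_abc k (a := 2) (b := 4) (c := 5) (by norm_num) (by norm_num),
    pCoord_abb_aux, pCoord_abc k (a := 1) (b := 4) (c := 5) (by norm_num) (by norm_num),
    pCoord_abc k (a := 2) (b := 3) (c := 4) (by norm_num) (by norm_num)]
  · simp only [map_sub, map_mul, map_neg, zero_mul, add_zero]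
    rw [D _ (Finset.mem_of_mem_erase h124) h124, D _ (Finset.mem_of_mem_erase h345) h345, D _ (Finset.mem_of_mem_erase h134) h134,
      D _ (Finset.mem_of_mem_erase h245) h245, D _ (Finset.mem_of_mem_erase h145) h145, D _ (Finset.mem_of_mem_erase h234) h234]
    ring
where
  /-- `p_{144} = 0`.
[cite: Hu2025, §3c closing question (C18L166), p.39 l.30–34 (unrefereed preprint arXiv:2507.21400v1 under adjudication, D-0012/D-0089
— kernel support on OUR typed carriers of row 101; nothing of the source asserted)] -/
  pCoord_abb_aux : (pCoord k 1 4 4 : PlRing 5 k) = 0 := by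
    have h0 : (pTri k (sort3 1 4 4) : PlRing 5 k) = 0 := by
      unfold pTri; rw [dif_neg]; unfold sort3 plIndexSet; decide
    rw [pCoord, h0, mul_zero]

/-- **`C18L166_R2` is FALSE AS TYPED at `n = 5`** over every nontrivial base ring.
[cite: Hu2025, §3c closing question (C18L166), p.39 l.30–34 (unrefereed preprint arXiv:2507.21400v1 under adjudication, D-0012/D-0089
— kernel support on OUR typed carriers of row 101; nothing of the source asserted)] -/
theorem not_C18L166_R2_five [Nontrivial k] : ¬ C18L166_R2 5 k := by
  classical
  intro h
  have h124 : ((1:ℕ),(2:ℕ),(4:ℕ)) ∈ plVarSet 5 := mem_plVarSet (by norm_num) (by norm_num) (by norm_num) (by norm_num) (by norm_num)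
  have h345 : ((3:ℕ),(4:ℕ),(5:ℕ)) ∈ plVarSet 5 := mem_plVarSet (by norm_num) (by norm_num) (by norm_num) le_rfl (by norm_num)
  have h134 : ((1:ℕ),(3:ℕ),(4:ℕ)) ∈ plVarSet 5 := mem_plVarSet (by norm_num) (by norm_num) (by norm_num) (by norm_num) (by norm_num)
  have h245 : ((2:ℕ),(4:ℕ),(5:ℕ)) ∈ plVarSet 5 := mem_plVarSet (by norm_num) (by norm_num) (by norm_num) le_rfl (by norm_num)
  have h145 : ((1:ℕ),(4:ℕ),(5:ℕ)) ∈ plVarSet 5 := mem_plVarSet (by norm_num) (by norm_num) (by norm_num) le_rfl (by norm_num)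
  have h234 : ((2:ℕ),(3:ℕ),(4:ℕ)) ∈ plVarSet 5 := mem_plVarSet (by norm_num) (by norm_num) (by norm_num) (by norm_num) (by norm_num)
  have hmem := adjoin_primaryFamily_le_evenSub_five
    (h ⟨by norm_num⟩ 1 4 2 3 4 5 (by norm_num) (by norm_num) (by norm_num) (by norm_num) (by norm_num) (by norm_num) (by norm_num)
      (by norm_num))
  rw [dehomog_plRel_14_2345 (k := k) h124 h345 h134 h245 h145 h234] at hmem
  -- the odd-weight monomial `x₁₂₄ x₃₄₅`
  set x124 : plVar 5 := ⟨_, h124⟩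
  set x345 : plVar 5 := ⟨_, h345⟩
  set x134 : plVar 5 := ⟨_, h134⟩
  set x245 : plVar 5 := ⟨_, h245⟩
  set x145 : plVar 5 := ⟨_, h145⟩
  set x234 : plVar 5 := ⟨_, h234⟩
  set d : plVar 5 →₀ ℕ := Finsupp.single x124 1 + Finsupp.single x345 1 with hd
  have hlt345 : IsLt ((3:ℕ),(4:ℕ),(5:ℕ)) := isLt_of_lt (a := 3) (by norm_num) (by norm_num)
  have hb124 : ¬ IsLt ((1:ℕ),(2:ℕ),(4:ℕ)) := not_isLt_of_le (by norm_num) (by norm_num) (by norm_num)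
  have hodd : ¬ Even (Finsupp.weight (pweight (n := 5)) d) := by
    rw [hd, map_add, Finsupp.weight_single, Finsupp.weight_single]
    simp only [pweight, x124, x345, if_pos hlt345, if_neg hb124]
    decide
  apply hodd (hmem d _)
  -- `d ∈ support`: the coefficient at `d` is `−1`
  rw [mem_support_iff]
  have ne1 : Finsupp.single x134 1 + Finsupp.single x245 1 ≠ d := by
    intro he
    have := Finsupp.ext_iff.mp he x134
    simp [hd, x124, x134, x245, x345] at this
  have ne2 : Finsupp.single x145 1 + Finsupp.single x234 1 ≠ d := by
    intro he
    have := Finsupp.ext_iff.mp he x145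
    simp [hd, x124, x145, x234, x345] at this
  rw [coeff_sub, coeff_add, coeff_neg, X, X, X, X, X, X, monomial_mul, monomial_mul, monomial_mul, coeff_monomial, coeff_monomial,
    coeff_monomial, if_pos hd.symm, if_neg ne1, if_neg ne2]
  norm_num

end Literature.AlgebraicGeometry.Hu2025.Statements.S03Pluecker

end
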